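import Literature.Barriers.RiemannHypothesis.JensenPolynomialsRowZeroObstruction
import Literature.Barriers.RiemannHypothesis.JensenPolynomialsChasse
import Literature.NumberTheory.LFunctions.JensenDegreeDescent
import Literature.NumberTheory.DiophantineGeometry.NamedHypotheses
import Literature.Analysis.Complex.JensenPolynomialSector
import Literature.NumberTheory.LFunctions.RiemannHypothesisUpTo1000X
import Literature.Analysis.Complex.FourierPolyaKiKimGenusZero
import Literature.Analysis.Complex.JensenLaguerreFlow
import Summits.RiemannHypothesis.Statement
import HarnessLib

/-!
# Splittings — the Jensen DEFLATION witness: a real entire function of order `< 1` whose zero set is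
# `{(ρ-½)² : ζ(ρ) = 0, 0 < Re ρ < 1, |Im ρ| ≥ H}`, RH-free (SPLIT-jen-finite gen 2, part 1/2)

Cell rh-split, seat rh-split-jen-finite g0/g2 (brief sha16 f79c5f09d8bcb036), card
`run/shared/lean/pub/rh-split/cards/SPLIT-jen-finite.md` §3 (deflation splitting) and gen-2 addendum (P1/T4).
Zero-definition raw form of `HOME/rh-split-jen-finite/Sketch2.lean` §3–§4 (sha16 4f853a51c395c629; proofs
verbatim): the seat-local deflated `w`-plane zero set `𝒵_H = {(ρ-½)² : ζ(ρ) = 0, 0 < Re ρ < 1, |Im ρ| ≥ H}` is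
SPELLED OUT as the predicate `∃ ρ, riemannZeta ρ = 0 ∧ 0 < ρ.re ∧ ρ.re < 1 ∧ H ≤ |ρ.im| ∧ w = (ρ - 1/2)²`.

Proved here (no `sorry`, standard axioms; nothing uses RH or a verified height):

* `deflatedZero_mem_sector` — `𝒵_H ⊆` Kim–Lee's sector `S(1/H)` UNCONDITIONALLY (`H > 0`), and
  `deflated_rowZero_splits` — RH-free Chasse for any real entire `F` of order `< 1`, `F 0 ≠ 0`, with zeros in
  `𝒵_H`: its row-`0` Jensen polynomials of every degree `d ≤ H²` are hyperbolic (tree: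
  `splits_jensenPoly_taylor_of_zeros_mem_sector`, Kim–Lee 2021 Remark after Thm 3);
* `deflatedWitness_exists` — **P1 / T4 of the card, every `H`**: a real entire function of order `< 1`,
  `F ∘ conj = conj ∘ F`, non-vanishing at `0`, with zero set EXACTLY `𝒵_H` and everywhere absolutely summable
  real Taylor data exists — a Hadamard SUB-PRODUCT of the genus-zero factorisation of `xiSq` over the fibres
  in `𝒵_H`, symmetrised `F₁ · conj ∘ F₁ ∘ conj` (no quotient, no Riemann–von Mangoldt finiteness; tree:
  `hadamard_genus_zero_zeros`, `KiKim.summable_norm_rpow_of_fibers`, `KiKim.norm_tprod_one_add_le_exp`,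
  `KiKim.isEntireOfOrderLt_one_of_exp_bound`);
* `deflatedWitness_rowZero_splits` — the RH-free dividend made concrete.

Part 2/2 (`JenDeflation.lean`) uses the witness to label the deflation splitting: its TAIL `B₂(H)` is
`RH above height H` by THEOREM for every `H`.

Referee (rh-split-ref g0) on cards/SPLIT-jen-finite.md, 19:26Z: «Sketch2 4f853a51c395c629 replayed rc 0, std on
deflatedWitnessExists and deflatedJensenHyperbolic_1000_iff_rh; P1 PROVED accepted (RH-free Hadamard
sub-product existence theorem); B(H) ⟺ RH(|Im| ≥ H) by theorem ⇒ JenDeflate(H) = RELABELLING simpliciter (zd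
partition costume, tail-lemma instance); R10–R12 endorsed; class UNCHANGED» — i.e. the splitting is the
height partition of the zeros in Jensen clothing: FIN is load-bearing but the TAIL is RH-above-H verbatim, so
as a route it has no new teeth.  Typer replay (rh-split-typer-1 g2): this raw form on the farm, rc 0,
0 warnings, 0 sorry, std axioms.  Filed by rh-split-typer-1 g2 on the lead's GO 2026-08-26T19:39Z
(HANDOFF-list item 2).

HONEST LABEL: «SPLITTING SEARCH over kernel-typed RH-EQUIVALENCES; a splitting A ∧ B ⟹ RH is CONDITIONAL
bookkeeping unless A and B are both proved; nothing here bears on the truth of RH.»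
-/

set_option linter.dupNamespace false

noncomputable section

open Polynomial Filter
open _root_.Complex
open scoped ComplexConjugate Nat

namespace Summit.RiemannHypothesis.RiemannHypothesis.Theorems.Splittings.JenDeflation

open Literature.NumberTheory.LFunctions Literature.Analysis.Complex.Obreschkoff
  Literature.Analysis.Complex.PolyaSchur Literature.Analysis.TotalPositivity
  Literature.NumberTheory.DiophantineGeometry Literature.Barriers.RiemannHypothesis

/-! ## §1 Elementary facts about the deflated zero set `𝒵_H` (spelled out) -/

/-- `Im (ρ - ½)² = 2 (Re ρ - ½) Im ρ`. [folklore] -/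
theorem im_sq_sub_half (ρ : ℂ) : ((ρ - 1 / 2) ^ 2).im = 2 * (ρ.re - 1 / 2) * ρ.im := by
  simp [sq]; ring

/-- Points of the deflated zero set are zeros of `G = xiSq`. -/
theorem xiSq_eq_zero_of_deflatedZero {H : ℝ} {w : ℂ}
    (hw : ∃ ρ : ℂ, riemannZeta ρ = 0 ∧ 0 < ρ.re ∧ ρ.re < 1 ∧ H ≤ |ρ.im| ∧ w = (ρ - 1 / 2) ^ 2) :
    xiSq w = 0 := by
  obtain ⟨ρ, hζ, h0, h1, -, rfl⟩ := hw
  have hξ : riemannXi ρ = 0 := (riemannXi_eq_zero_iff_holds ρ).2 ⟨hζ, h0, h1⟩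
  rwa [riemannXi_eq_xiSq] at hξ

/-- The deflated zero set is closed under conjugation (`ζ(conj s) = conj ζ(s)`). -/
theorem conj_deflatedZero {H : ℝ} {w : ℂ}
    (hw : ∃ ρ : ℂ, riemannZeta ρ = 0 ∧ 0 < ρ.re ∧ ρ.re < 1 ∧ H ≤ |ρ.im| ∧ w = (ρ - 1 / 2) ^ 2) :
    ∃ ρ : ℂ, riemannZeta ρ = 0 ∧ 0 < ρ.re ∧ ρ.re < 1 ∧ H ≤ |ρ.im| ∧ conj w = (ρ - 1 / 2) ^ 2 := by
  obtain ⟨ρ, hζ, h0, h1, hH, rfl⟩ := hw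
  refine ⟨conj ρ, by rw [riemannZeta_conj, hζ, map_zero], by simpa using h0, by simpa using h1,
    by simpa using hH, ?_⟩
  simp only [map_pow, map_sub, map_div₀, map_one, map_ofNat]

/-- A real point `(ρ - ½)²` over a zero of `ζ` in the open strip forces `Re ρ = ½` (`ζ` has no zeros on
the real segment `(0,1)`, tree: `riemannZeta_ne_zero_of_im_eq_zero_of_pos_of_lt_one`). -/
theorem re_eq_half_of_im_sq_eq_zero {ρ : ℂ} (hζ : riemannZeta ρ = 0) (h0 : 0 < ρ.re)
    (h1 : ρ.re < 1) (him : ((ρ - 1 / 2) ^ 2).im = 0) : ρ.re = 1 / 2 := by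
  rw [im_sq_sub_half] at him
  rcases mul_eq_zero.1 him with h | him0
  · rcases mul_eq_zero.1 h with h2 | hre
    · norm_num at h2
    · linarith
  · exact absurd hζ (riemannZeta_ne_zero_of_im_eq_zero_of_pos_of_lt_one him0 h0 h1)

/-- The deflated zero set lies in Kim–Lee's sector `S(1/H)` UNCONDITIONALLY (`H > 0`): for
`|γ| ≥ H`, `|Im (ρ-½)²| = 2|β-½||γ| ≤ |γ| ≤ |γ|²/H ≤ ‖(ρ-½)²‖/H` — the computation of
`xiSq_zeros_mem_sector`, with Chasse's RH-height hypothesis replaced by the object's definition. -/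
theorem deflatedZero_mem_sector {H : ℝ} (hH : 0 < H) {w : ℂ}
    (hw : ∃ ρ : ℂ, riemannZeta ρ = 0 ∧ 0 < ρ.re ∧ ρ.re < 1 ∧ H ≤ |ρ.im| ∧ w = (ρ - 1 / 2) ^ 2) :
    w ∈ sector H⁻¹ := by
  obtain ⟨ρ, -, h0, h1, hH', rfl⟩ := hw
  rw [mem_sector]
  have hnorm : ‖(ρ - 1 / 2) ^ 2‖ = (ρ.re - 1 / 2) ^ 2 + ρ.im ^ 2 := by
    rw [norm_pow, Complex.sq_norm, normSq_apply]
    simp; ring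
  have hx : |ρ.re - 1 / 2| ≤ 1 / 2 := by rw [abs_le]; constructor <;> linarith
  rw [im_sq_sub_half, hnorm, le_inv_mul_iff₀ hH]
  have hy0 : 0 ≤ |ρ.im| := abs_nonneg _
  calc H * |2 * (ρ.re - 1 / 2) * ρ.im| = H * (2 * |ρ.re - 1 / 2| * |ρ.im|) := by
        rw [abs_mul, abs_mul, abs_two]
    _ ≤ H * |ρ.im| := by
        refine mul_le_mul_of_nonneg_left ?_ hH.le
        nlinarith
    _ ≤ |ρ.im| * |ρ.im| := mul_le_mul_of_nonneg_right hH' hy0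
    _ = ρ.im ^ 2 := by rw [← sq, sq_abs]
    _ ≤ (ρ.re - 1 / 2) ^ 2 + ρ.im ^ 2 := le_add_of_nonneg_left (sq_nonneg _)

/-- **RH-free Chasse for a deflated function.**  Any real entire `F` of order `< 1` with `F 0 ≠ 0`
whose zeros lie in the deflated zero set has `J^{d,0}` (of its Taylor data) hyperbolic for every
`d ≤ H²` — NO hypothesis on the zeros of `ζ` (tree: `splits_jensenPoly_taylor_of_zeros_mem_sector`,
Kim–Lee 2021 Remark after Thm 3). These `⌊H²⌋` cells of `B₂(H)` are theorems, not certificates. -/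
theorem deflated_rowZero_splits {H : ℝ} (hH : 0 < H) {F : ℂ → ℂ} (hF : IsEntireOfOrderLtOne F)
    (hreal : ∀ z, F (conj z) = conj (F z)) (h0 : F 0 ≠ 0)
    (hzero : ∀ w : ℂ, F w = 0 →
      ∃ ρ : ℂ, riemannZeta ρ = 0 ∧ 0 < ρ.re ∧ ρ.re < 1 ∧ H ≤ |ρ.im| ∧ w = (ρ - 1 / 2) ^ 2)
    {d : ℕ} (hd : (d : ℝ) ≤ H ^ 2) :
    (jensenPoly (fun k => (iteratedDeriv k F 0).re) d 0).Splits := by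
  have hδ : (d : ℝ) * H⁻¹ ^ 2 ≤ 1 := by
    rw [inv_pow, ← div_eq_mul_inv]
    exact div_le_one_of_le₀ hd (by positivity)
  exact splits_jensenPoly_taylor_of_zeros_mem_sector hF hreal h0
    (fun z hz => deflatedZero_mem_sector hH (hzero z hz)) hδ

/-! ## §3 P1 / T4 PROVED (RH-free): the deflated witness exists, for every `H`

The witness is built as a Hadamard SUB-PRODUCT, not as a quotient: from the genus-zero factorisation
`G(z) = G(0) ∏ (1 - bₙ z)` of `G = xiSq` (tree: `hadamard_genus_zero_zeros`, multiplicities encoded as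
fibres) keep exactly the factors whose zero `bₙ⁻¹` lies in the deflated zero set, and symmetrise
(`F(z) = F₁(z) · conj F₁(conj z)`) so that the Taylor data are real without any bookkeeping of conjugate
fibres.  Every ingredient is a tree theorem with standard axioms; nothing here uses RH or F1. -/

/-- Taylor majorant of an entire function: `Σ |Re F⁽ʲ⁾(0)|/j! · Rʲ < ∞` (Cauchy's estimate on the circle
of radius `2R+1`). [folklore] -/
theorem summable_taylor_re_of_entire {F : ℂ → ℂ} (hF : Differentiable ℂ F) (R : ℝ) (hR : 0 ≤ R) :
    Summable fun j => |(iteratedDeriv j F 0).re| / (j ! : ℝ) * R ^ j := by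
  obtain ⟨R', hR'⟩ : ∃ R' : ℝ, R' = 2 * R + 1 := ⟨_, rfl⟩
  have hR'0 : 0 < R' := by rw [hR']; linarith
  obtain ⟨M, hM⟩ := (isCompact_sphere (0 : ℂ) R').exists_bound_of_continuousOn
    hF.continuous.continuousOn
  have hq0 : 0 ≤ R / R' := div_nonneg hR hR'0.le
  have hq1 : R / R' < 1 := (div_lt_one hR'0).mpr (by rw [hR']; linarith)
  have hbound : ∀ j : ℕ, |(iteratedDeriv j F 0).re| / (j ! : ℝ) * R ^ j ≤ M * (R / R') ^ j := by
    intro j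
    have hc := Complex.norm_iteratedDeriv_le_of_forall_mem_sphere_norm_le (f := F) (c := 0) j hR'0
      hF.diffContOnCl (fun z hz => hM z hz)
    have h1 : |(iteratedDeriv j F 0).re| ≤ (j ! : ℝ) * M / R' ^ j :=
      (Complex.abs_re_le_norm _).trans hc
    have hj : (0 : ℝ) < j ! := by exact_mod_cast Nat.factorial_pos j
    calc |(iteratedDeriv j F 0).re| / (j ! : ℝ) * R ^ j ≤ ((j ! : ℝ) * M / R' ^ j) / (j ! : ℝ) * R ^ j :=
          mul_le_mul_of_nonneg_right (div_le_div_of_nonneg_right h1 hj.le) (pow_nonneg hR j)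
      _ = M * (R / R') ^ j := by rw [div_pow]; field_simp
  refine Summable.of_nonneg_of_le (fun j => by positivity) hbound ?_
  exact (summable_geometric_of_lt_one hq0 hq1).mul_left M

/-- Taylor expansion of an entire function with real derivatives at `0`, in the cell's `γⱼ wʲ/j!` form.
[folklore] -/
theorem hasSum_taylor_re_of_entire {F : ℂ → ℂ} (hF : Differentiable ℂ F)
    (hreal : ∀ n, (iteratedDeriv n F 0).im = 0) (w : ℂ) :
    HasSum (fun j => (((iteratedDeriv j F 0).re : ℝ) : ℂ) / (j ! : ℂ) * w ^ j) (F w) := by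
  have h := Complex.hasSum_taylorSeries_of_entire hF 0 w
  simp only [sub_zero, smul_eq_mul] at h
  have hre : ∀ n, (((iteratedDeriv n F 0).re : ℝ) : ℂ) = iteratedDeriv n F 0 := fun n =>
    Complex.ext (by simp) (by simp [hreal n])
  have hfun : (fun j => (((iteratedDeriv j F 0).re : ℝ) : ℂ) / (j ! : ℂ) * w ^ j) =
      fun n => (n ! : ℂ)⁻¹ * (w ^ n * iteratedDeriv n F 0) := by
    funext n
    rw [hre n, div_eq_mul_inv]
    ring
  rw [hfun]
  exact h

/-- **P1 (T4 of the cell's offer list), PROVED RH-free: the deflated witness exists for every `H`.**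
There is a real entire `F` of order `< 1` (`IsEntireOfOrderLtOne`), `F ∘ conj = conj ∘ F`, with everywhere
absolutely convergent real Taylor data `γ = (Re F⁽ᵏ⁾(0))_k`, `F 0 ≠ 0`, whose zero set is EXACTLY the deflated
zero set `{(ρ-½)² : ζ(ρ) = 0, 0 < Re ρ < 1, |Im ρ| ≥ H}`. -/
theorem deflatedWitness_exists (H : ℝ) :
    ∃ (F : ℂ → ℂ) (γ : ℕ → ℝ),
      IsEntireOfOrderLtOne F ∧ (∀ z, F (conj z) = conj (F z)) ∧
      (∀ R : ℝ, 0 ≤ R → Summable fun j => |γ j| / (j ! : ℝ) * R ^ j) ∧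
      (∀ w : ℂ, HasSum (fun j => (γ j : ℂ) / (j ! : ℂ) * w ^ j) (F w)) ∧
      (γ = fun k => (iteratedDeriv k F 0).re) ∧
      F 0 ≠ 0 ∧
      (∀ w : ℂ, F w = 0 ↔
        ∃ ρ : ℂ, riemannZeta ρ = 0 ∧ 0 < ρ.re ∧ ρ.re < 1 ∧ H ≤ |ρ.im| ∧ w = (ρ - 1 / 2) ^ 2) := by
  classical
  /- Hadamard data for `G = xiSq` (order `< 1`, `G(0) = ξ(½) ≠ 0`). -/
  obtain ⟨hd, ρ₀, C₀, hρ₀, hgr₀⟩ := isEntireOfOrderLtOne_xiSq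
  obtain ⟨σ, C, hσ1, hC1, hgr⟩ :=
    Literature.Analysis.Complex.HadamardGenusZero.growth_normalise hd hρ₀ hgr₀
  obtain ⟨b, hsum, hzero, hfib, -⟩ :=
    Literature.Analysis.Complex.hadamard_genus_zero_zeros xiSq σ C hd hσ1 hgr xiSq_zero_ne
  obtain ⟨τ, hτ⟩ : ∃ τ : ℝ, τ = max ((σ + 1) / 2) (1 / 2) := ⟨_, rfl⟩
  have hτ0 : 0 < τ := by rw [hτ]; exact lt_max_of_lt_right (by norm_num)
  have hτ1 : τ < 1 := by rw [hτ]; exact max_lt (by linarith) (by norm_num)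
  have hστ : σ < τ := by rw [hτ]; exact lt_max_of_lt_left (by linarith)
  have hbτ : Summable fun n => ‖b n‖ ^ τ :=
    Literature.Analysis.Complex.KiKim.summable_norm_rpow_of_fibers hd xiSq_zero_ne hσ1 hC1 hgr hστ
      hτ0 hzero hfib
  /- The deflated coefficient sequence: keep the factor `1 - bₙ z` iff its zero is of height `≥ H`. -/
  obtain ⟨a, ha⟩ : ∃ a : ℕ → ℂ, a = fun n =>
      if (∃ ρ : ℂ, riemannZeta ρ = 0 ∧ 0 < ρ.re ∧ ρ.re < 1 ∧ H ≤ |ρ.im| ∧ (b n)⁻¹ = (ρ - 1 / 2) ^ 2)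
      then -b n else 0 :=
    ⟨_, rfl⟩
  have na : ∀ n, ‖a n‖ ≤ ‖b n‖ := fun n => by
    rw [ha]; dsimp only; split_ifs <;> simp
  have sa : Summable fun n => ‖a n‖ := hsum.of_nonneg_of_le (fun n => norm_nonneg _) na
  have saτ : Summable fun n => ‖a n‖ ^ τ :=
    hbτ.of_nonneg_of_le (fun n => by positivity) fun n =>
      Real.rpow_le_rpow (norm_nonneg _) (na n) hτ0.le
  obtain ⟨B, hB⟩ : ∃ B : ℝ, B = 2 / τ * ∑' n, ‖a n‖ ^ τ := ⟨_, rfl⟩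
  have hB0 : 0 ≤ B := by
    rw [hB]; exact mul_nonneg (by positivity) (tsum_nonneg fun n => by positivity)
  /- The sub-product `F₁ = G(0) ∏ (1 + aₙ z)` and its symmetrisation `F`. -/
  obtain ⟨F₁, hF₁⟩ : ∃ F₁ : ℂ → ℂ, F₁ = fun z => xiSq 0 * ∏' n, (1 + a n * z) := ⟨_, rfl⟩
  have hF₁d : Differentiable ℂ F₁ := by
    rw [hF₁]; exact (differentiable_tprod_one_add sa).const_mul _
  have hF₁gr : ∀ z, ‖F₁ z‖ ≤ ‖xiSq 0‖ * Real.exp (B * ‖z‖ ^ τ) := by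
    intro z
    rw [hF₁, hB]; dsimp only
    rw [norm_mul]
    exact mul_le_mul_of_nonneg_left
      (Literature.Analysis.Complex.KiKim.norm_tprod_one_add_le_exp sa hτ0 hτ1.le saτ z) (norm_nonneg _)
  have hF₁0 : F₁ 0 = xiSq 0 := by rw [hF₁]; simp
  have hF₁zero : ∀ w, F₁ w = 0 ↔
      ∃ ρ : ℂ, riemannZeta ρ = 0 ∧ 0 < ρ.re ∧ ρ.re < 1 ∧ H ≤ |ρ.im| ∧ w = (ρ - 1 / 2) ^ 2 := by
    intro w
    rw [hF₁]; dsimp only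
    constructor
    · intro hw
      rcases mul_eq_zero.1 hw with h | h
      · exact absurd h xiSq_zero_ne
      · obtain ⟨n, hn⟩ := exists_factor_eq_zero_of_tprod_eq_zero sa h
        have hmem : ∃ ρ : ℂ, riemannZeta ρ = 0 ∧ 0 < ρ.re ∧ ρ.re < 1 ∧ H ≤ |ρ.im| ∧
            (b n)⁻¹ = (ρ - 1 / 2) ^ 2 := by
          by_contra hc
          rw [ha] at hn; dsimp only at hn
          rw [if_neg hc] at hn
          simp at hn
        have han : a n = -b n := by rw [ha]; dsimp only; rw [if_pos hmem]
        rw [han] at hn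
        have hmul : b n * w = 1 := by linear_combination -hn
        rw [eq_inv_of_mul_eq_one_right hmul]
        exact hmem
    · intro hw
      have hx : xiSq w = 0 := xiSq_eq_zero_of_deflatedZero hw
      have hw0 : w ≠ 0 := fun h => xiSq_zero_ne (h ▸ hx)
      obtain ⟨n, hn⟩ : ∃ n, b n = w⁻¹ := by
        have h1 : {n : ℕ | b n = w⁻¹}.ncard ≠ 0 := by
          rw [hfib w hw0]
          exact (Literature.Analysis.Complex.HadamardGenusZero.analyticOrderNatAt_ne_zero_iff hd
            xiSq_zero_ne w).mpr hx
        obtain ⟨n, hn⟩ := Set.nonempty_of_ncard_ne_zero h1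
        exact ⟨n, hn⟩
      have hmem : ∃ ρ : ℂ, riemannZeta ρ = 0 ∧ 0 < ρ.re ∧ ρ.re < 1 ∧ H ≤ |ρ.im| ∧
          (b n)⁻¹ = (ρ - 1 / 2) ^ 2 := by rw [hn, inv_inv]; exact hw
      refine mul_eq_zero_of_right _
        (Literature.Analysis.Complex.KiKim.tprod_one_add_eq_zero_of_factor sa (n₀ := n) ?_)
      rw [ha]; dsimp only
      rw [if_pos hmem, hn, neg_mul, inv_mul_cancel₀ hw0]
      ring
  obtain ⟨F, hF⟩ : ∃ F : ℂ → ℂ, F = fun z => F₁ z * (conj ∘ F₁ ∘ conj) z := ⟨_, rfl⟩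
  have hF₂d : Differentiable ℂ (conj ∘ F₁ ∘ conj) := fun z =>
    differentiableAt_conj_conj_iff.mpr (hF₁d (conj z))
  have hFd : Differentiable ℂ F := by rw [hF]; exact hF₁d.mul hF₂d
  have hFgr : ∀ z, ‖F z‖ ≤ ‖xiSq 0‖ ^ 2 * Real.exp (2 * B * ‖z‖ ^ τ) := by
    intro z
    rw [hF]; dsimp only [Function.comp]
    rw [norm_mul, Complex.norm_conj]
    have h1 := hF₁gr z
    have h2 := hF₁gr (conj z)
    rw [Complex.norm_conj] at h2
    calc ‖F₁ z‖ * ‖F₁ (conj z)‖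
        ≤ (‖xiSq 0‖ * Real.exp (B * ‖z‖ ^ τ)) * (‖xiSq 0‖ * Real.exp (B * ‖z‖ ^ τ)) :=
          mul_le_mul h1 h2 (norm_nonneg _) (by positivity)
      _ = ‖xiSq 0‖ ^ 2 * Real.exp (2 * B * ‖z‖ ^ τ) := by
          rw [show 2 * B * ‖z‖ ^ τ = B * ‖z‖ ^ τ + B * ‖z‖ ^ τ by ring, Real.exp_add]; ring
  have hlt : Literature.Analysis.Complex.IsEntireOfOrderLt 1 F :=
    Literature.Analysis.Complex.KiKim.isEntireOfOrderLt_one_of_exp_bound hFd (A := ‖xiSq 0‖ ^ 2)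
      (B := 2 * B) (by positivity) (by positivity) hτ0.le hτ1 hFgr
  have hF1 : IsEntireOfOrderLtOne F := by
    obtain ⟨hd', ρ', C', hρ', h'⟩ := hlt
    exact ⟨hd', ρ', C', hρ', h'⟩
  have hFconj : ∀ z, F (conj z) = conj (F z) := by
    intro z
    simp only [hF, Function.comp, map_mul, Complex.conj_conj]
    ring
  have hF0 : F 0 ≠ 0 := by
    rw [hF]; dsimp only [Function.comp]
    rw [map_zero, hF₁0]
    exact mul_ne_zero xiSq_zero_ne (by rw [Ne, map_eq_zero]; exact xiSq_zero_ne)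
  have hFzero : ∀ w, F w = 0 ↔
      ∃ ρ : ℂ, riemannZeta ρ = 0 ∧ 0 < ρ.re ∧ ρ.re < 1 ∧ H ≤ |ρ.im| ∧ w = (ρ - 1 / 2) ^ 2 := by
    intro w
    rw [hF]; dsimp only [Function.comp]
    rw [mul_eq_zero, map_eq_zero, hF₁zero, hF₁zero]
    constructor
    · rintro (h | h)
      · exact h
      · simpa using conj_deflatedZero h
    · exact fun h => Or.inl h
  have hFreal : ∀ x : ℝ, (F x).im = 0 := by
    intro x
    rw [hF]; dsimp only [Function.comp]
    rw [Complex.conj_ofReal, Complex.mul_conj, Complex.ofReal_im]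
  have hderiv : ∀ n, (iteratedDeriv n F 0).im = 0 := fun n => by
    simpa using Literature.Analysis.Complex.KiKim.im_iteratedDeriv_ofReal_eq_zero hFd hFreal n 0
  exact ⟨F, fun k => (iteratedDeriv k F 0).re, hF1, hFconj, summable_taylor_re_of_entire hFd,
    hasSum_taylor_re_of_entire hFd hderiv, rfl, hF0, hFzero⟩

/-- **The RH-free dividend made concrete:** for `H > 0` there IS a real entire function of order `< 1`,
non-vanishing at `0`, with zero set exactly the deflated zero set, whose row-`0` Jensen polynomials of
every degree `d ≤ H²` are hyperbolic — unconditionally (Chasse/Kim–Lee for the deflated object). -/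
theorem deflatedWitness_rowZero_splits {H : ℝ} (hH : 0 < H) :
    ∃ F : ℂ → ℂ, IsEntireOfOrderLtOne F ∧ (∀ z, F (conj z) = conj (F z)) ∧ F 0 ≠ 0 ∧
      (∀ w : ℂ, F w = 0 ↔
        ∃ ρ : ℂ, riemannZeta ρ = 0 ∧ 0 < ρ.re ∧ ρ.re < 1 ∧ H ≤ |ρ.im| ∧ w = (ρ - 1 / 2) ^ 2) ∧
      ∀ d : ℕ, (d : ℝ) ≤ H ^ 2 → (jensenPoly (fun k => (iteratedDeriv k F 0).re) d 0).Splits := by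
  obtain ⟨F, γ, hF, hreal, -, -, -, h0, hzero⟩ := deflatedWitness_exists H
  exact ⟨F, hF, hreal, h0, hzero, fun d hd =>
    deflated_rowZero_splits hH hF hreal h0 (fun w hw => (hzero w).1 hw) hd⟩

end Summit.RiemannHypothesis.RiemannHypothesis.Theorems.Splittings.JenDeflation

end
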